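/-
Copyright (c) 2026 the pub-hodgecm-mathlib formalisation cell (harness21).  Prover seat hodgecm-mathlib-K2E1-p13 (g3), Track B ∕ K2-LIT, h413 = `stmt-HodgeConjecture-24833`,
line `K2_E1_TraceFormulaBeta`, route of record `HCCMUnconditional`; dealer K2E1-plan (g7) (252)∕(253): «K2E4-p14 B2 model form → K2E1-p13 consumes» — the (d)-realness ∕ `hs` letters
at M1 with the MODEL DATA `F ∕ hFd ∕ hrel` of ★ `K2E1ChiScatteringRealPolesM1CMTwo` §4 PAID by ★ B2 `K2E1ChiMaassSelbergPairingModelCMTwo` on the per-ball truncated families.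
-/
import Summits.HodgeConjecture.HodgeConjecture.Theorems.K2E1ChiScatteringRealPolesM1CMTwo      -- ★ p860605 (this seat): `chi_scattering_hreal_m1_cm_two`, `chi_scattering_hs_m1_cm_two`, `chi_scattering_noComplexPole_m1_cm_two`
import Summits.HodgeConjecture.HodgeConjecture.Theorems.K2E1ChiMaassSelbergPairingModelCMTwo    -- ★ p860575 B2 (K2E4-p14): `inner_truncatedFamily_eq_fourTerm_chi_model_cm_two`
import HarnessLib

/-!
# K2·E1 — `K2E1ChiScatteringRealPolesOfModelM1CMTwo`: `hreal` AND `hs` FOR THE SCATTERING COORDINATES OF A SELF-DUAL UNITARY `χ` OF `U(1,1)_{L∕L⁺}` FROM THE χ-MAASS–SELBERG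
# RELATION IN MODEL FORM — ★ `K2E1ChiScatteringRealPolesM1CMTwo` §4 with its model letters `F ∕ hFd ∕ hrel` DISCHARGED by ★ B2 on the per-ball truncated families

Track B ∕ K2-LIT, crux h413 = `stmt-HodgeConjecture-24833`; cell `hodgecm-mathlib`, squad K2, ENGINE E1, campaign «5Res», (d)-block at M1 (consumer: K2E1-p14 (g2)'s (SD) M1 final assembly
`K2E1ChiSectionPlancherelSelfDualM1CMTwo`, binders `hs ∕ S ∕ hS ∕ hUo ∕ hUs`).  THEOREMS ONLY (no `def`, no `instance`, no notation, no named-fact hypothesis, no `sorry`; default heartbeats);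
lane `--kind proof --supports stmt-HodgeConjecture-24833 --as helper` (count-neutral).  Closes no socket.

THE MATHEMATICS ([MoeglinWaldspurger1995, II.1.7, IV.2.3, IV.3.12 (a)]; [BernsteinLapid2019, Thm 2.3, §4]; [Arthur1980TraceFormulaII, §4]).  The χ-Maass–Selberg relation for the truncated
continued Eisenstein series of a SELF-DUAL unitary `χ` reads, in the `L²(K_U)`-model (★ B2 `inner_truncatedFamily_eq_fourTerm_chi_model_cm_two`: `V = Lp ℂ 2 μK`, `κ = ∫_{𝓕_I∩{‖x‖≤1}} ‖x‖`,
`m = 1`), `⟪F z′, F z⟫ = cμ·K·R(z, z′; κ⟪·,·⟫)` for ANY `ψ : ℂ → L²(K_U)` agreeing a.e. on the tube with the intertwined coefficient `φ̃_z|_K`.  We take THE model section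
`ψ z := Σ_j qc_j(z) • bK_j` built from the continued scattering coordinates `qc_j` and the `L²(K_U)`-classes `bK_j` of the basis sections `b_j` (★ M1 print: `Σ_j q_j(z) b_j = (ν𝓕)⁻¹·φ̃_z` on
the tube, `qc_j = q_j` there; `ν𝓕 = 1`): then `ψ z =ᵐ φ̃_z|_K` on the tube (§1 `coeFn_sum_smul_ae`), so ★ B2 pays, ball by ball (`D₁(n) = (D⁺ ∩ D_n ∩ U_n) ∖ P`, families `Fam n` of the SAME
`Ec` with `Fam n z =ᵐ Λ^{T₀ n} Ec z` on `U_n ∖ P` — the (α) family export — and (E1) `Ec z = E(f_z^φ)` on the tube), EXACTLY the `hrel` letter of ★ `chi_scattering_hs_m1_cm_two`; its other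
letters are the package clauses (`hqNF hqa hPc hPcd hPre`), `hψ := rfl`, `κ > 0`, `φK ≠ 0`, `LinearIndependent bK`.  RESULT: for every coordinate `j` and every `σ₀ > 1`, **`hreal`** (every
genuine pole of `qc_j` in `½ < Re ≤ σ₀` is real and `< σ₀`) and, given (FE), **`hs`** (a finset `S ⊂ (½, σ₀)` of real poles and an open `U′ ⊇ {½ ≤ Re ≤ σ₀}` with `qc_j` holomorphic on
`U′ ∖ S`).  REMAINING VISIBLE LETTERS, all with named payers: `hdec′` per ball (K2E4-p10 (b), ★ `K2E1HeightLineArchSmoothU2` `_const` edition), the families `U T₀ Fam hFd hFam` (K2E1-p12 (α)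
`K2E1ChiEisensteinM1FamilyExportCMTwo`), `hconj` (★ p860445), `hFE` (★ p860120 ∕ K2E1-p14 `K2E1ChiScatteringFunctionalEquationM1CMTwo`), and the structural data of ★ B1∕B2.
* §1 `coeFn_sum_smul_ae` (a.e. representative of a finite `Lp`-combination).
* §2 **`chi_scattering_noComplexPole_of_model_m1_cm_two`**, **`chi_scattering_hreal_of_model_m1_cm_two`**, **`chi_scattering_hs_of_model_m1_cm_two`**.
HONEST LABEL: HC_CM is proved only modulo the 7 printed citations (2 remaining named inputs: hLiu418 = `stmt-HodgeConjecture-24832`, h413 = `stmt-HodgeConjecture-24833`) until rung 0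
closes; this file asserts no named fact, is conditional by construction on its visible binders, and closes no socket.

## References
* [MoeglinWaldspurger1995] C. Mœglin, J.-L. Waldspurger, *Spectral decomposition and Eisenstein series* (1995), II.1.7, IV.2.3, IV.3.12 (a).
* [BernsteinLapid2019] J. Bernstein, E. Lapid, *On the meromorphic continuation of Eisenstein series*, J. AMS 37 (2024), Thm 2.3, §4.
* [Arthur1980TraceFormulaII] J. Arthur, *A trace formula for reductive groups II*, Compositio Math. 40 (1980), §4.
-/

set_option autoImplicit false
set_option linter.dupNamespace false  -- the mandated namespace repeats the summit's segment (`HodgeConjecture.HodgeConjecture`)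

noncomputable section

open MeasureTheory MeasureTheory.Measure Set NumberField IsDedekindDomain Filter Topology Metric
open scoped NNReal ENNReal ComplexConjugate InnerProductSpace
open Literature.MeasureTheory.Group Literature.NumberTheory
open Literature.NumberTheory.Automorphic Literature.NumberTheory.Automorphic.UnitaryGroup AdelicGroupData
open Literature.NumberTheory.GaloisRepresentations
open Summit.HodgeConjecture.HodgeConjecture.Cruxes.H413.K2E1BorelEisensteinU
open Summit.HodgeConjecture.HodgeConjecture.Cruxes.H413.K2E1CharacterEisensteinU2Defs
open Summit.HodgeConjecture.HodgeConjecture.Cruxes.H413.K2E1ChiMaassSelbergPairingModelCMTwo (inner_truncatedFamily_eq_fourTerm_chi_model_cm_two)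
open Summit.HodgeConjecture.HodgeConjecture.Cruxes.H413.K2E1ChiScatteringRealPolesM1CMTwo (chi_scattering_noComplexPole_m1_cm_two chi_scattering_hreal_m1_cm_two chi_scattering_hs_m1_cm_two)

namespace Summit.HodgeConjecture.HodgeConjecture.Cruxes.H413.K2E1ChiScatteringRealPolesOfModelM1CMTwo

/-! ## §1 The a.e. representative of a finite `Lp`-combination -/

/-- **`⇑(Σ_j c_j • u_j) =ᵐ Σ_j c_j·g_j`** for `L²`-classes `u_j` with a.e. representatives `g_j` (`Lp.coeFn_add`, `Lp.coeFn_smul`, induction on the finset). [folklore] -/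
theorem coeFn_sum_smul_ae {X : Type*} [MeasurableSpace X] {μX : Measure X} {ι' : Type*} (s : Finset ι') (c : ι' → ℂ) (u : ι' → Lp ℂ 2 μX) (g : ι' → X → ℂ)
    (hu : ∀ j, ((u j : Lp ℂ 2 μX) : X → ℂ) =ᵐ[μX] g j) :
    ((∑ j ∈ s, c j • u j : Lp ℂ 2 μX) : X → ℂ) =ᵐ[μX] fun x => ∑ j ∈ s, c j * g j x := by
  classical
  induction s using Finset.induction_on with
  | empty =>
      simp only [Finset.sum_empty]
      exact Lp.coeFn_zero ℂ 2 μX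
  | @insert a s ha ih =>
      simp only [Finset.sum_insert ha]
      filter_upwards [Lp.coeFn_add (c a • u a) (∑ j ∈ s, c j • u j), Lp.coeFn_smul (c a) (u a), hu a, ih] with x h1 h2 h3 h4
      rw [h1, Pi.add_apply, h2, Pi.smul_apply, h3, h4, smul_eq_mul]

/-! ## §2 The heads at M1: no complex pole, `hreal`, `hs` — ★ §4 with `hrel` paid by ★ B2 -/

section Heads

variable (L : Type) [Field L] [NumberField L] [IsCMField L]
variable [MeasurableSpace (quasiSplit (↥(maximalRealSubfield L)) L (IsCMField.complexConj L) 2).Adelic] [BorelSpace (quasiSplit (↥(maximalRealSubfield L)) L (IsCMField.complexConj L) 2).Adelic]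
variable [MeasurableSpace (AdeleRing (𝓞 L) L)ˣ] [BorelSpace (AdeleRing (𝓞 L) L)ˣ]

/-- **NO POLE OFF THE REAL AXIS IN `½ < Re z` FOR THE SCATTERING COORDINATES OF A SELF-DUAL UNITARY `χ` AT M1** — ★ `chi_scattering_noComplexPole_m1_cm_two` with `V := L²(K_U, μ_K)`,
`ψ z := Σ_j qc_j(z) • bK_j`, `κ := ∫_{𝓕_I∩{‖x‖≤1}} ‖x‖`, `m := 1`, and the per-ball model relation PAID by ★ B2 on the families `Fam n` (module docstring).  Letters: B1∕B2's structural data,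
the package clauses, the `L²(K_U)` classes, `κ > 0`, the families with `hdec′`, and the reflection symmetry `hconj`. [cite: MoeglinWaldspurger1995, IV.2.3, IV.3.12 (a)] [cite: BernsteinLapid2019, §4] -/
theorem chi_scattering_noComplexPole_of_model_m1_cm_two
    (μ : Measure (quasiSplit (↥(maximalRealSubfield L)) L (IsCMField.complexConj L) 2).automorphicQuotient) [(quasiSplit (↥(maximalRealSubfield L)) L (IsCMField.complexConj L) 2).IsAutomorphicMeasure μ]
    (νG : Measure (quasiSplit (↥(maximalRealSubfield L)) L (IsCMField.complexConj L) 2).Adelic) [νG.IsHaarMeasure] [νG.IsInvInvariant]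
    (μK : Measure ((standardMaximalCompactGL 2 L).comap (adelicVal (↥(maximalRealSubfield L)) L (IsCMField.complexConj L) 2 ((StdForm.antidiagonal 2).over L)) : Subgroup (quasiSplit (↥(maximalRealSubfield L)) L (IsCMField.complexConj L) 2).Adelic)) [μK.IsHaarMeasure]
    (νI : Measure (AdeleRing (𝓞 L) L)ˣ) [νI.IsHaarMeasure]
    {𝓕I : Set (AdeleRing (𝓞 L) L)ˣ} (h𝓕I : IsIdeleClassDomain L 𝓕I)
    (ν : Measure ↥(adelicUnipotent (↥(maximalRealSubfield L)) L (IsCMField.complexConj L) 2)) [ν.IsHaarMeasure]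
    {𝓕 : Set ↥(adelicUnipotent (↥(maximalRealSubfield L)) L (IsCMField.complexConj L) 2)} (h𝓕N : IsFundamentalDomain ↥(rationalUnipotent (↥(maximalRealSubfield L)) L (IsCMField.complexConj L) 2) 𝓕 ν) (h𝓕1 : ν 𝓕 = 1)
    (h𝓕c : IsCompact (closure 𝓕))
    {β : (quasiSplit (↥(maximalRealSubfield L)) L (IsCMField.complexConj L) 2).Adelic → ℝ≥0∞} (hβ : IsCoveringWeight ((arithmeticBorel (↥(maximalRealSubfield L)) L (IsCMField.complexConj L) 2).map (quasiSplit (↥(maximalRealSubfield L)) L (IsCMField.complexConj L) 2).arithmeticSubgroup.subtype) β)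
    -- the self-dual unitary character and the M1 section
    {χ : HeckeCharacter L} (hχ : χ.IsUnitary) (hρ : ∀ r : ℝ≥0ˣ, χ (posRealIdele L r) = 1) (hsd : reflectChar (IsCMField.complexConj L) χ = χ)
    {φ : (quasiSplit (↥(maximalRealSubfield L)) L (IsCMField.complexConj L) 2).Adelic → ℂ} (hφc : Continuous φ) (hφ : IsChiSection χ φ) {Cφ : ℝ} (hφC : ∀ x, ‖φ x‖ ≤ Cφ)
    -- the meromorphic package (★ M1 print ∕ (α) family export clause shapes): basis functions `b j`, tube coordinates `q j`, continued `qc j`, `Ec`, pole set `P`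
    {ι' : Type} [Fintype ι'] (b : ι' → (quasiSplit (↥(maximalRealSubfield L)) L (IsCMField.complexConj L) 2).Adelic → ℂ) {q qc : ι' → ℂ → ℂ} {Ec : ℂ → (quasiSplit (↥(maximalRealSubfield L)) L (IsCMField.complexConj L) 2).Adelic → ℂ} {P : Set ℂ}
    (hqφ : ∀ z : ℂ, 1 < z.re → (∑ j, q j z • b j) = ((((ν 𝓕).toReal⁻¹ : ℝ)) : ℂ) • (fun g : (quasiSplit (↥(maximalRealSubfield L)) L (IsCMField.complexConj L) 2).Adelic => (∫ v : ↥(adelicUnipotent (↥(maximalRealSubfield L)) L (IsCMField.complexConj L) 2), flatSectionU φ z ((quasiSplit (↥(maximalRealSubfield L)) L (IsCMField.complexConj L) 2).toAdelic (weylLongU ((IsCMField.complexConj L : L ≃ₐ[↥(maximalRealSubfield L)] L) : L →+* L) (rfl : (StdForm.antidiagonal 2).over L = (StdForm.antidiagonal 2).over L)) * ((v : (quasiSplit (↥(maximalRealSubfield L)) L (IsCMField.complexConj L) 2).Adelic) * g)) ∂ν) * ((borelHeight g : ℝ) : ℂ) ^ (z - 1)))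
    (hqNF : ∀ j, MeromorphicNFOn (qc j) univ) (hE1 : ∀ z : ℂ, 1 < z.re → Ec z = eisensteinSeriesU (flatSectionU φ z)) (hqcq : ∀ j (z : ℂ), 1 < z.re → qc j z = q j z)
    (hPc : IsClosed P) (hPcd : ∀ z₀ : ℂ, ∀ᶠ s in 𝓝[≠] z₀, s ∉ P) (hqa : ∀ j (z : ℂ), z ∉ P → AnalyticAt ℂ (qc j) z)
    -- the `L²(K_U)` classes of `φ` and of the basis, and the idelic bracket constant
    (φK : Lp ℂ 2 μK) (hφK : ((φK : Lp ℂ 2 μK) : _ → ℂ) =ᵐ[μK] fun k => φ (k : (quasiSplit (↥(maximalRealSubfield L)) L (IsCMField.complexConj L) 2).Adelic)) (hφK0 : φK ≠ 0)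
    (bK : ι' → Lp ℂ 2 μK) (hbK : ∀ j, ((bK j : Lp ℂ 2 μK) : _ → ℂ) =ᵐ[μK] fun k => b j (k : (quasiSplit (↥(maximalRealSubfield L)) L (IsCMField.complexConj L) 2).Adelic)) (hbKli : LinearIndependent ℂ bK)
    (hκ : 0 < (∫ x in {x : (AdeleRing (𝓞 L) L)ˣ | (IdeleClassGroup.ideleNorm L x : ℝ) ≤ 1} ∩ 𝓕I, (IdeleClassGroup.ideleNorm L x : ℝ) ∂νI))
    -- the per-ball truncated families of the SAME `Ec` ((α) export clause shapes) and the survivor `hdec′`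
    (U : ℕ → Set ℂ) (hUo : ∀ n, IsOpen (U n)) (hUcod : ∀ n : ℕ, ∀ z₀ ∈ Metric.ball (0 : ℂ) (n + 2), ∀ᶠ s in 𝓝[≠] z₀, s ∈ U n)
    (T₀ : ℕ → ℝ≥0) (hT₀ : ∀ n, 1 ≤ T₀ n) (Fam : ℕ → ℂ → Lp ℂ 2 μ) (hFd : ∀ n, DifferentiableOn ℂ (Fam n) (U n \ P))
    (hFam : ∀ n, ∀ z ∈ U n \ P, ((Fam n z : Lp ℂ 2 μ) : (quasiSplit (↥(maximalRealSubfield L)) L (IsCMField.complexConj L) 2).automorphicQuotient → ℂ) =ᵐ[μ] (quasiSplit (↥(maximalRealSubfield L)) L (IsCMField.complexConj L) 2).quotFun (truncation ν 𝓕 (T₀ n) (Ec z)))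
    (hdec' : ∀ (n : ℕ) (z' : ℂ), 1 < z'.re → ∃ M₁ : ℝ, ∀ g : (quasiSplit (↥(maximalRealSubfield L)) L (IsCMField.complexConj L) 2).Adelic, T₀ n < borelHeight g →
      ‖eisensteinSeriesU (flatSectionU φ z') g - borelConstantTerm ν 𝓕 (eisensteinSeriesU (flatSectionU φ z')) g‖ ≤ M₁)
    (hconj : ∀ j (z : ℂ), z ∉ P → conj z ∉ P → qc j (conj z) = conj (qc j z)) :
    ∀ j (z₁ : ℂ), 1 / 2 < z₁.re → z₁.im ≠ 0 → AnalyticAt ℂ (qc j) z₁ := by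
  classical
  -- the tube identity of the model section `ψ z := Σ_j qc_j(z) • bK_j`
  have h1r : ((((ν 𝓕).toReal⁻¹ : ℝ)) : ℂ) = 1 := by rw [h𝓕1, ENNReal.toReal_one, inv_one, Complex.ofReal_one]
  have hψtube : ∀ z : ℂ, 1 < z.re → ((∑ j, qc j z • bK j : Lp ℂ 2 μK) : _ → ℂ) =ᵐ[μK] fun k => (fun g : (quasiSplit (↥(maximalRealSubfield L)) L (IsCMField.complexConj L) 2).Adelic => (∫ v : ↥(adelicUnipotent (↥(maximalRealSubfield L)) L (IsCMField.complexConj L) 2), flatSectionU φ z ((quasiSplit (↥(maximalRealSubfield L)) L (IsCMField.complexConj L) 2).toAdelic (weylLongU ((IsCMField.complexConj L : L ≃ₐ[↥(maximalRealSubfield L)] L) : L →+* L) (rfl : (StdForm.antidiagonal 2).over L = (StdForm.antidiagonal 2).over L)) * ((v : (quasiSplit (↥(maximalRealSubfield L)) L (IsCMField.complexConj L) 2).Adelic) * g)) ∂ν) * ((borelHeight g : ℝ) : ℂ) ^ (z - 1)) (k : (quasiSplit (↥(maximalRealSubfield L)) L (IsCMField.complexConj L) 2).Adelic) := by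
    intro z hz
    refine (coeFn_sum_smul_ae Finset.univ (fun j => qc j z) bK (fun j k => b j (k : (quasiSplit (↥(maximalRealSubfield L)) L (IsCMField.complexConj L) 2).Adelic)) hbK).trans (Eventually.of_forall fun k => ?_)
    have happ := congrFun (hqφ z hz) (k : (quasiSplit (↥(maximalRealSubfield L)) L (IsCMField.complexConj L) 2).Adelic)
    rw [Finset.sum_apply, Pi.smul_apply, h1r, one_smul] at happ
    simp only [Pi.smul_apply, smul_eq_mul] at happ
    beta_reduce
    rw [← happ]
    exact Finset.sum_congr rfl fun j _ => by rw [hqcq j z hz]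
  -- the tube identity of the families on the ball domains
  have hsub : ∀ n : ℕ, (({z : ℂ | 1 / 2 < z.re ∧ 0 < z.im} ∩ Metric.ball (0 : ℂ) (n + 2) ∩ U n) \ P) ⊆ U n \ P := fun n z hz => ⟨hz.1.2, hz.2⟩
  have hFtube : ∀ n : ℕ, ∀ z ∈ (({z : ℂ | 1 / 2 < z.re ∧ 0 < z.im} ∩ Metric.ball (0 : ℂ) (n + 2) ∩ U n) \ P), 1 < z.re →
      ((Fam n z : Lp ℂ 2 μ) : (quasiSplit (↥(maximalRealSubfield L)) L (IsCMField.complexConj L) 2).automorphicQuotient → ℂ) =ᵐ[μ] (quasiSplit (↥(maximalRealSubfield L)) L (IsCMField.complexConj L) 2).quotFun (truncation ν 𝓕 (T₀ n) (eisensteinSeriesU (flatSectionU φ z))) := by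
    intro n z hz hz1
    rw [← hE1 z hz1]
    exact hFam n z (hsub n hz)
  -- ★ B2, ball by ball
  choose cμ K hcμ hK hrel using fun n : ℕ =>
    inner_truncatedFamily_eq_fourTerm_chi_model_cm_two L μ νG μK νI h𝓕I ν h𝓕N h𝓕1 h𝓕c hβ (hT₀ n) hχ hρ hφc hφ hφC hφc hφ hφC (hdec' n) (Fam n) (Fam n) (hFtube n) (hFtube n)
      hsd φK φK hφK hφK (fun z => ∑ j, qc j z • bK j) (fun z => ∑ j, qc j z • bK j) (fun z _ hz => hψtube z hz) (fun z _ hz => hψtube z hz)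
  -- ★ §4
  exact chi_scattering_noComplexPole_m1_cm_two (V := Lp ℂ 2 μK) hPc hPcd hqNF hqa hbKli one_ne_zero (ψ := fun z => ∑ j, qc j z • bK j) (fun z _ => (one_smul ℂ _).symm)
    hκ one_pos hφK0 U hUo hUcod (T := fun n => ((T₀ n : ℝ≥0) : ℝ)) (fun n => by exact_mod_cast hT₀ n) hcμ hK Fam (fun n _ => (hFd n).mono (hsub n)) (fun n _ => hrel n)
    hconj

/-- **THE (d)-REALNESS LETTER `hreal` AT M1 FOR A SELF-DUAL UNITARY `χ`** — every NON-ANALYTIC point of `qc_j` with `½ < Re z ≤ σ₀` (`σ₀ > 1`) is REAL with `Re z < σ₀` (★ §4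
`chi_scattering_hreal_m1_cm_two`, model relation PAID by ★ B2; VERBATIM the `hreal` binder of ★ `exists_finset_differentiableOn_halfStrip_of_fe_of_conj`).
[cite: MoeglinWaldspurger1995, IV.1.11, IV.3.12 (a)] [cite: BernsteinLapid2019, §4] -/
theorem chi_scattering_hreal_of_model_m1_cm_two
    (μ : Measure (quasiSplit (↥(maximalRealSubfield L)) L (IsCMField.complexConj L) 2).automorphicQuotient) [(quasiSplit (↥(maximalRealSubfield L)) L (IsCMField.complexConj L) 2).IsAutomorphicMeasure μ]
    (νG : Measure (quasiSplit (↥(maximalRealSubfield L)) L (IsCMField.complexConj L) 2).Adelic) [νG.IsHaarMeasure] [νG.IsInvInvariant]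
    (μK : Measure ((standardMaximalCompactGL 2 L).comap (adelicVal (↥(maximalRealSubfield L)) L (IsCMField.complexConj L) 2 ((StdForm.antidiagonal 2).over L)) : Subgroup (quasiSplit (↥(maximalRealSubfield L)) L (IsCMField.complexConj L) 2).Adelic)) [μK.IsHaarMeasure]
    (νI : Measure (AdeleRing (𝓞 L) L)ˣ) [νI.IsHaarMeasure]
    {𝓕I : Set (AdeleRing (𝓞 L) L)ˣ} (h𝓕I : IsIdeleClassDomain L 𝓕I)
    (ν : Measure ↥(adelicUnipotent (↥(maximalRealSubfield L)) L (IsCMField.complexConj L) 2)) [ν.IsHaarMeasure]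
    {𝓕 : Set ↥(adelicUnipotent (↥(maximalRealSubfield L)) L (IsCMField.complexConj L) 2)} (h𝓕N : IsFundamentalDomain ↥(rationalUnipotent (↥(maximalRealSubfield L)) L (IsCMField.complexConj L) 2) 𝓕 ν) (h𝓕1 : ν 𝓕 = 1)
    (h𝓕c : IsCompact (closure 𝓕))
    {β : (quasiSplit (↥(maximalRealSubfield L)) L (IsCMField.complexConj L) 2).Adelic → ℝ≥0∞} (hβ : IsCoveringWeight ((arithmeticBorel (↥(maximalRealSubfield L)) L (IsCMField.complexConj L) 2).map (quasiSplit (↥(maximalRealSubfield L)) L (IsCMField.complexConj L) 2).arithmeticSubgroup.subtype) β)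
    -- the self-dual unitary character and the M1 section
    {χ : HeckeCharacter L} (hχ : χ.IsUnitary) (hρ : ∀ r : ℝ≥0ˣ, χ (posRealIdele L r) = 1) (hsd : reflectChar (IsCMField.complexConj L) χ = χ)
    {φ : (quasiSplit (↥(maximalRealSubfield L)) L (IsCMField.complexConj L) 2).Adelic → ℂ} (hφc : Continuous φ) (hφ : IsChiSection χ φ) {Cφ : ℝ} (hφC : ∀ x, ‖φ x‖ ≤ Cφ)
    -- the meromorphic package (★ M1 print ∕ (α) family export clause shapes): basis functions `b j`, tube coordinates `q j`, continued `qc j`, `Ec`, pole set `P`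
    {ι' : Type} [Fintype ι'] (b : ι' → (quasiSplit (↥(maximalRealSubfield L)) L (IsCMField.complexConj L) 2).Adelic → ℂ) {q qc : ι' → ℂ → ℂ} {Ec : ℂ → (quasiSplit (↥(maximalRealSubfield L)) L (IsCMField.complexConj L) 2).Adelic → ℂ} {P : Set ℂ}
    (hqφ : ∀ z : ℂ, 1 < z.re → (∑ j, q j z • b j) = ((((ν 𝓕).toReal⁻¹ : ℝ)) : ℂ) • (fun g : (quasiSplit (↥(maximalRealSubfield L)) L (IsCMField.complexConj L) 2).Adelic => (∫ v : ↥(adelicUnipotent (↥(maximalRealSubfield L)) L (IsCMField.complexConj L) 2), flatSectionU φ z ((quasiSplit (↥(maximalRealSubfield L)) L (IsCMField.complexConj L) 2).toAdelic (weylLongU ((IsCMField.complexConj L : L ≃ₐ[↥(maximalRealSubfield L)] L) : L →+* L) (rfl : (StdForm.antidiagonal 2).over L = (StdForm.antidiagonal 2).over L)) * ((v : (quasiSplit (↥(maximalRealSubfield L)) L (IsCMField.complexConj L) 2).Adelic) * g)) ∂ν) * ((borelHeight g : ℝ) : ℂ) ^ (z - 1)))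
    (hqNF : ∀ j, MeromorphicNFOn (qc j) univ) (hE1 : ∀ z : ℂ, 1 < z.re → Ec z = eisensteinSeriesU (flatSectionU φ z)) (hqcq : ∀ j (z : ℂ), 1 < z.re → qc j z = q j z)
    (hPc : IsClosed P) (hPcd : ∀ z₀ : ℂ, ∀ᶠ s in 𝓝[≠] z₀, s ∉ P) (hqa : ∀ j (z : ℂ), z ∉ P → AnalyticAt ℂ (qc j) z)
    -- the `L²(K_U)` classes of `φ` and of the basis, and the idelic bracket constant
    (φK : Lp ℂ 2 μK) (hφK : ((φK : Lp ℂ 2 μK) : _ → ℂ) =ᵐ[μK] fun k => φ (k : (quasiSplit (↥(maximalRealSubfield L)) L (IsCMField.complexConj L) 2).Adelic)) (hφK0 : φK ≠ 0)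
    (bK : ι' → Lp ℂ 2 μK) (hbK : ∀ j, ((bK j : Lp ℂ 2 μK) : _ → ℂ) =ᵐ[μK] fun k => b j (k : (quasiSplit (↥(maximalRealSubfield L)) L (IsCMField.complexConj L) 2).Adelic)) (hbKli : LinearIndependent ℂ bK)
    (hκ : 0 < (∫ x in {x : (AdeleRing (𝓞 L) L)ˣ | (IdeleClassGroup.ideleNorm L x : ℝ) ≤ 1} ∩ 𝓕I, (IdeleClassGroup.ideleNorm L x : ℝ) ∂νI))
    -- the per-ball truncated families of the SAME `Ec` ((α) export clause shapes) and the survivor `hdec′`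
    (U : ℕ → Set ℂ) (hUo : ∀ n, IsOpen (U n)) (hUcod : ∀ n : ℕ, ∀ z₀ ∈ Metric.ball (0 : ℂ) (n + 2), ∀ᶠ s in 𝓝[≠] z₀, s ∈ U n)
    (T₀ : ℕ → ℝ≥0) (hT₀ : ∀ n, 1 ≤ T₀ n) (Fam : ℕ → ℂ → Lp ℂ 2 μ) (hFd : ∀ n, DifferentiableOn ℂ (Fam n) (U n \ P))
    (hFam : ∀ n, ∀ z ∈ U n \ P, ((Fam n z : Lp ℂ 2 μ) : (quasiSplit (↥(maximalRealSubfield L)) L (IsCMField.complexConj L) 2).automorphicQuotient → ℂ) =ᵐ[μ] (quasiSplit (↥(maximalRealSubfield L)) L (IsCMField.complexConj L) 2).quotFun (truncation ν 𝓕 (T₀ n) (Ec z)))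
    (hdec' : ∀ (n : ℕ) (z' : ℂ), 1 < z'.re → ∃ M₁ : ℝ, ∀ g : (quasiSplit (↥(maximalRealSubfield L)) L (IsCMField.complexConj L) 2).Adelic, T₀ n < borelHeight g →
      ‖eisensteinSeriesU (flatSectionU φ z') g - borelConstantTerm ν 𝓕 (eisensteinSeriesU (flatSectionU φ z')) g‖ ≤ M₁)
    (hPre : ∀ z ∈ P, z.re ≤ 1) (hconj : ∀ j (z : ℂ), z ∉ P → conj z ∉ P → qc j (conj z) = conj (qc j z)) {σ₀ : ℝ} (hσ₀ : 1 < σ₀) :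
    ∀ j (z : ℂ), ¬ AnalyticAt ℂ (qc j) z → 1 / 2 < z.re → z.re ≤ σ₀ → z.im = 0 ∧ z.re < σ₀ := by
  have hnc := chi_scattering_noComplexPole_of_model_m1_cm_two L μ νG μK νI h𝓕I ν h𝓕N h𝓕1 h𝓕c hβ hχ hρ hsd hφc hφ hφC b hqφ hqNF hE1 hqcq hPc hPcd hqa φK hφK hφK0 bK hbK hbKli
    hκ U hUo hUcod T₀ hT₀ Fam hFd hFam hdec' hconj
  intro j z hz hzre _
  have hzP : z ∈ P := by
    by_contra h
    exact hz (hqa j z h)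
  refine ⟨?_, lt_of_le_of_lt (hPre z hzP) hσ₀⟩
  by_contra him
  exact hz (hnc j z hzre him)

/-- **`hreal` AND THE ENTRY LETTER `hs` AT M1 FOR A SELF-DUAL UNITARY `χ`** — given also the scalar functional equation (FE) `qc_j(z)·qc_j(1 − z) = 1` off `P ∪ (1 − P)`: `hreal`, and a finset
`S ⊂ (½, σ₀)` of genuine real poles with an open `U′ ⊇ {½ ≤ Re ≤ σ₀}` on which `qc_j` is holomorphic off `S` — the `hs ∕ S ∕ hS ∕ hUo ∕ hUs` binders of the (SD) M1 final assembly (★ §4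
`chi_scattering_hs_m1_cm_two` ∘ ★ p860392 §4). [cite: MoeglinWaldspurger1995, IV.1.11, IV.3.12 (a)] [cite: BernsteinLapid2019, §4] -/
theorem chi_scattering_hs_of_model_m1_cm_two
    (μ : Measure (quasiSplit (↥(maximalRealSubfield L)) L (IsCMField.complexConj L) 2).automorphicQuotient) [(quasiSplit (↥(maximalRealSubfield L)) L (IsCMField.complexConj L) 2).IsAutomorphicMeasure μ]
    (νG : Measure (quasiSplit (↥(maximalRealSubfield L)) L (IsCMField.complexConj L) 2).Adelic) [νG.IsHaarMeasure] [νG.IsInvInvariant]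
    (μK : Measure ((standardMaximalCompactGL 2 L).comap (adelicVal (↥(maximalRealSubfield L)) L (IsCMField.complexConj L) 2 ((StdForm.antidiagonal 2).over L)) : Subgroup (quasiSplit (↥(maximalRealSubfield L)) L (IsCMField.complexConj L) 2).Adelic)) [μK.IsHaarMeasure]
    (νI : Measure (AdeleRing (𝓞 L) L)ˣ) [νI.IsHaarMeasure]
    {𝓕I : Set (AdeleRing (𝓞 L) L)ˣ} (h𝓕I : IsIdeleClassDomain L 𝓕I)
    (ν : Measure ↥(adelicUnipotent (↥(maximalRealSubfield L)) L (IsCMField.complexConj L) 2)) [ν.IsHaarMeasure]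
    {𝓕 : Set ↥(adelicUnipotent (↥(maximalRealSubfield L)) L (IsCMField.complexConj L) 2)} (h𝓕N : IsFundamentalDomain ↥(rationalUnipotent (↥(maximalRealSubfield L)) L (IsCMField.complexConj L) 2) 𝓕 ν) (h𝓕1 : ν 𝓕 = 1)
    (h𝓕c : IsCompact (closure 𝓕))
    {β : (quasiSplit (↥(maximalRealSubfield L)) L (IsCMField.complexConj L) 2).Adelic → ℝ≥0∞} (hβ : IsCoveringWeight ((arithmeticBorel (↥(maximalRealSubfield L)) L (IsCMField.complexConj L) 2).map (quasiSplit (↥(maximalRealSubfield L)) L (IsCMField.complexConj L) 2).arithmeticSubgroup.subtype) β)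
    -- the self-dual unitary character and the M1 section
    {χ : HeckeCharacter L} (hχ : χ.IsUnitary) (hρ : ∀ r : ℝ≥0ˣ, χ (posRealIdele L r) = 1) (hsd : reflectChar (IsCMField.complexConj L) χ = χ)
    {φ : (quasiSplit (↥(maximalRealSubfield L)) L (IsCMField.complexConj L) 2).Adelic → ℂ} (hφc : Continuous φ) (hφ : IsChiSection χ φ) {Cφ : ℝ} (hφC : ∀ x, ‖φ x‖ ≤ Cφ)
    -- the meromorphic package (★ M1 print ∕ (α) family export clause shapes): basis functions `b j`, tube coordinates `q j`, continued `qc j`, `Ec`, pole set `P`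
    {ι' : Type} [Fintype ι'] (b : ι' → (quasiSplit (↥(maximalRealSubfield L)) L (IsCMField.complexConj L) 2).Adelic → ℂ) {q qc : ι' → ℂ → ℂ} {Ec : ℂ → (quasiSplit (↥(maximalRealSubfield L)) L (IsCMField.complexConj L) 2).Adelic → ℂ} {P : Set ℂ}
    (hqφ : ∀ z : ℂ, 1 < z.re → (∑ j, q j z • b j) = ((((ν 𝓕).toReal⁻¹ : ℝ)) : ℂ) • (fun g : (quasiSplit (↥(maximalRealSubfield L)) L (IsCMField.complexConj L) 2).Adelic => (∫ v : ↥(adelicUnipotent (↥(maximalRealSubfield L)) L (IsCMField.complexConj L) 2), flatSectionU φ z ((quasiSplit (↥(maximalRealSubfield L)) L (IsCMField.complexConj L) 2).toAdelic (weylLongU ((IsCMField.complexConj L : L ≃ₐ[↥(maximalRealSubfield L)] L) : L →+* L) (rfl : (StdForm.antidiagonal 2).over L = (StdForm.antidiagonal 2).over L)) * ((v : (quasiSplit (↥(maximalRealSubfield L)) L (IsCMField.complexConj L) 2).Adelic) * g)) ∂ν) * ((borelHeight g : ℝ) : ℂ) ^ (z - 1)))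
    (hqNF : ∀ j, MeromorphicNFOn (qc j) univ) (hE1 : ∀ z : ℂ, 1 < z.re → Ec z = eisensteinSeriesU (flatSectionU φ z)) (hqcq : ∀ j (z : ℂ), 1 < z.re → qc j z = q j z)
    (hPc : IsClosed P) (hPcd : ∀ z₀ : ℂ, ∀ᶠ s in 𝓝[≠] z₀, s ∉ P) (hqa : ∀ j (z : ℂ), z ∉ P → AnalyticAt ℂ (qc j) z)
    -- the `L²(K_U)` classes of `φ` and of the basis, and the idelic bracket constant
    (φK : Lp ℂ 2 μK) (hφK : ((φK : Lp ℂ 2 μK) : _ → ℂ) =ᵐ[μK] fun k => φ (k : (quasiSplit (↥(maximalRealSubfield L)) L (IsCMField.complexConj L) 2).Adelic)) (hφK0 : φK ≠ 0)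
    (bK : ι' → Lp ℂ 2 μK) (hbK : ∀ j, ((bK j : Lp ℂ 2 μK) : _ → ℂ) =ᵐ[μK] fun k => b j (k : (quasiSplit (↥(maximalRealSubfield L)) L (IsCMField.complexConj L) 2).Adelic)) (hbKli : LinearIndependent ℂ bK)
    (hκ : 0 < (∫ x in {x : (AdeleRing (𝓞 L) L)ˣ | (IdeleClassGroup.ideleNorm L x : ℝ) ≤ 1} ∩ 𝓕I, (IdeleClassGroup.ideleNorm L x : ℝ) ∂νI))
    -- the per-ball truncated families of the SAME `Ec` ((α) export clause shapes) and the survivor `hdec′`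
    (U : ℕ → Set ℂ) (hUo : ∀ n, IsOpen (U n)) (hUcod : ∀ n : ℕ, ∀ z₀ ∈ Metric.ball (0 : ℂ) (n + 2), ∀ᶠ s in 𝓝[≠] z₀, s ∈ U n)
    (T₀ : ℕ → ℝ≥0) (hT₀ : ∀ n, 1 ≤ T₀ n) (Fam : ℕ → ℂ → Lp ℂ 2 μ) (hFd : ∀ n, DifferentiableOn ℂ (Fam n) (U n \ P))
    (hFam : ∀ n, ∀ z ∈ U n \ P, ((Fam n z : Lp ℂ 2 μ) : (quasiSplit (↥(maximalRealSubfield L)) L (IsCMField.complexConj L) 2).automorphicQuotient → ℂ) =ᵐ[μ] (quasiSplit (↥(maximalRealSubfield L)) L (IsCMField.complexConj L) 2).quotFun (truncation ν 𝓕 (T₀ n) (Ec z)))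
    (hdec' : ∀ (n : ℕ) (z' : ℂ), 1 < z'.re → ∃ M₁ : ℝ, ∀ g : (quasiSplit (↥(maximalRealSubfield L)) L (IsCMField.complexConj L) 2).Adelic, T₀ n < borelHeight g →
      ‖eisensteinSeriesU (flatSectionU φ z') g - borelConstantTerm ν 𝓕 (eisensteinSeriesU (flatSectionU φ z')) g‖ ≤ M₁)
    (hPre : ∀ z ∈ P, z.re ≤ 1) (hFE : ∀ j (z : ℂ), z ∉ P → 1 - z ∉ P → qc j z * qc j (1 - z) = 1)
    (hconj : ∀ j (z : ℂ), z ∉ P → conj z ∉ P → qc j (conj z) = conj (qc j z)) {σ₀ : ℝ} (hσ₀ : 1 < σ₀) (j : ι') :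
    (∀ z : ℂ, ¬ AnalyticAt ℂ (qc j) z → 1 / 2 < z.re → z.re ≤ σ₀ → z.im = 0 ∧ z.re < σ₀) ∧
      ∃ (S : Finset ℝ) (U' : Set ℂ), (∀ x ∈ S, ¬ AnalyticAt ℂ (qc j) (x : ℂ) ∧ 1 / 2 < x ∧ x < σ₀) ∧ IsOpen U' ∧ {z : ℂ | 1 / 2 ≤ z.re ∧ z.re ≤ σ₀} ⊆ U' ∧
        DifferentiableOn ℂ (qc j) (U' \ ((S.image fun x : ℝ => (x : ℂ)) : Set ℂ)) := by
  have hreal := chi_scattering_hreal_of_model_m1_cm_two L μ νG μK νI h𝓕I ν h𝓕N h𝓕1 h𝓕c hβ hχ hρ hsd hφc hφ hφC b hqφ hqNF hE1 hqcq hPc hPcd hqa φK hφK hφK0 bK hbK hbKli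
    hκ U hUo hUcod T₀ hT₀ Fam hFd hFam hdec' hPre hconj hσ₀ j
  exact ⟨hreal, K2E1MeromorphicStripFinitePoles.exists_finset_differentiableOn_halfStrip_of_fe_of_conj (hqNF j) hPcd (hqa j) (hFE j) (hconj j) hreal⟩

end Heads

end Summit.HodgeConjecture.HodgeConjecture.Cruxes.H413.K2E1ChiScatteringRealPolesOfModelM1CMTwo

end
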